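import Literature.Topology.FourManifolds.CoupleRigidity

/-!
# The entrance charts of the sphere of directions: local inverses

Topic `Literature/Topology/FourManifolds` (support of `stmt-SmoothPoincare4-15190`, structure
conjugacy; sequel of `BoundaryPlanarisationCores.lean`, dimension `3`, boxes of index `1`).
Everything here is **proved**.

For one-level saddle data `Q` of a basin pair and a saddle `s`, the direction map
`y ↦ entDir s b y` (`BoundaryPlanarisationCores.lean`: the direction, on the small level sphere,
of the trajectory through the entrance-sheet point `entW s b y`) is a smooth injection of the disc
`‖y‖² < ε²` into the sphere of radius `rad`.  Here we give its **explicit smooth inverse**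

* `SaddleData.entBack Q s u = yv (coord_s (levelProj (c - ε²) (ofChart u)))` — flow the chart point
  of `u` up to the entrance level and read its transverse Milnor coordinates:

`entBack (entDir y) = y` (`entBack_entDir`); on the open set `entDom s b δ` of chart vectors whose
ray meets the entrance level inside the entrance set of `s` at the end `b`, `entDir (entBack u) = u`
for `‖u‖ = rad` (`entDir_entBack`), `entBack` is smooth (`contMDiffAt_entBack`) and `entDir y`
lies in `entDom` (`entDir_mem_entDom`).  So the unit entrance charts
`y ↦ unitVec (entDir s b y)` are diffeomorphisms of small discs onto open subsets of `S²` — the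
form in which the disc theorem is applied to them.

## References

* J. Milnor, *Lectures on the h-cobordism theorem* (1965), Def. 3.9, Thm. 4.1, proof of
  Thm. 3.12 (PDF pp. 16–22). [MilnorHCobordism1965]
-/

open scoped Manifold ContDiff Topology
open Set Function Filter Metric

noncomputable section

namespace Literature.Topology.FourManifolds

open Cobordism FourManifolds.Flow TracePolar

universe u

namespace BasinPair.SaddleData

variable {W : Type u} [TopologicalSpace W] [T2Space W] [SecondCountableTopology W]
  [CompactSpace W] [ChartedSpace (EuclideanHalfSpace (2 + 1)) W] [IsManifold (𝓡∂ (2 + 1)) ∞ W]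
  {g : W → ℝ} {ξA ξB : Π x : W, TangentSpace (𝓡∂ (2 + 1)) x} {P : BasinPair g ξA ξB} (Q : P.SaddleData)

/-- Local notation for the model plane and space. -/
local notation "E2" => EuclideanSpace ℝ (Fin 2)
local notation "E3" => EuclideanSpace ℝ (Fin 3)

/-! ### The inverse of the direction map -/

/-- **The entrance point of the ray of `u`**: the point of the entrance level on the trajectory
through the chart point of `u`. [cite: MilnorHCobordism1965, Def. 3.9, Thm. 4.1] -/
def entOf (u : E3) : W := levelProj P.A.θ g Q.entLevel (P.A.ofChart u)

/-- **The inverse of the direction map**: the transverse Milnor coordinates of the entrance point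
of the ray. [cite: MilnorHCobordism1965, proof of Thm. 3.12 (PDF p. 18)] -/
def entBack (s : SaddlePt 2 g) (u : E3) : E2 := yv ((Q.DA s).coord (Q.entOf u))

variable {Q}

/-- Unfolding `entOf`. [folklore] -/
theorem entOf_def (u : E3) : Q.entOf u = levelProj P.A.θ g Q.entLevel (P.A.ofChart u) := rfl

/-- Unfolding `entBack`. [folklore] -/
theorem entBack_def (s : SaddlePt 2 g) (u : E3) : Q.entBack s u = yv ((Q.DA s).coord (Q.entOf u)) := rfl

variable {s : SaddlePt 2 g} (hk : (Q.DA s).k = 1) {b : Bool} {y : E2}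
include hk

/-- **The entrance point of the ray of `entDir s b y` is `entW s b y`** (`‖y‖² < ε²`). [folklore] -/
theorem entOf_entDir (hy : ‖y‖ ^ 2 < Q.ε ^ 2) : Q.entOf (Q.entDir s b y) = Q.entW s b y := by
  rw [entOf_def, ofChart_entDir hk hy,
    P.A.levelProj_levelProj (not_isMCriticalPt_entW hk hy) _ (P.A.Ioo_subset_slab entLevel_mem_Ioo)
      ⟨0, by rw [P.A.θ_zero]; exact apply_entW hk hy⟩]
  exact P.A.levelProj_eq_self (not_isMCriticalPt_entW hk hy) (P.A.Ioo_subset_slab entLevel_mem_Ioo) (apply_entW hk hy)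

/-- **`entBack ∘ entDir = id`** on `‖y‖² < ε²`. [folklore] -/
theorem entBack_entDir (hy : ‖y‖ ^ 2 < Q.ε ^ 2) : Q.entBack s (Q.entDir s b y) = y := by
  rw [entBack_def, entOf_entDir hk hy, (entW_mem_chartBall (Q := Q) (s := s) (b := b) hy).2, yv_entPoint]

omit hk in
variable (Q) in
/-- **The domain of the inverse at the end `b`**: chart vectors whose ray meets the entrance level,
at a point of the entrance set of `s` of width `δ` whose first Milnor coordinate has the sign of
the end `b`. [folklore] -/
def entDom (s : SaddlePt 2 g) (b : Bool) (δ : ℝ) : Set E3 :=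
  {u | ‖u‖ < P.A.r₀ ∧ u ≠ 0 ∧ Hits P.A.θ g Q.entLevel (P.A.ofChart u) ∧ Q.entOf u ∈ Q.Uent s δ ∧
    0 < boolSign b * (Q.DA s).coord (Q.entOf u) 0}

omit hk in
/-- Membership in `entDom`. [folklore] -/
theorem mem_entDom_iff {δ : ℝ} {u : E3} : u ∈ Q.entDom s b δ ↔
    ‖u‖ < P.A.r₀ ∧ u ≠ 0 ∧ Hits P.A.θ g Q.entLevel (P.A.ofChart u) ∧ Q.entOf u ∈ Q.Uent s δ ∧
      0 < boolSign b * (Q.DA s).coord (Q.entOf u) 0 := Iff.rfl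

omit hk in
/-- The first Milnor coordinate of an entrance-sheet point has the sign of its end. [folklore] -/
theorem boolSign_mul_entPoint_zero_pos {ε : ℝ} (hε : 0 < ε) (b : Bool) (y : E2) : 0 < boolSign b * entPoint ε b y 0 := by
  rw [entPoint_apply_zero, ← mul_assoc]
  have h1 : boolSign b * boolSign b = 1 := by cases b <;> simp [boolSign]
  rw [h1, one_mul]; positivity

omit hk in
/-- Ends are determined by the sign of the first coordinate. [folklore] -/
theorem eq_of_boolSign_mul_pos {b b' : Bool} {t : ℝ} (h : 0 < boolSign b * t) (h' : 0 < boolSign b' * t) : b = b' := by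
  cases b <;> cases b' <;> simp [boolSign] at h h' ⊢ <;> linarith

/-- **The direction vectors lie in the domain of the inverse** (`‖y‖² < δ ≤ ε²`). [folklore] -/
theorem entDir_mem_entDom {δ : ℝ} (hδ : δ ≤ Q.ε ^ 2) (hy : ‖y‖ ^ 2 < δ) : Q.entDir s b y ∈ Q.entDom s b δ := by
  have hyε : ‖y‖ ^ 2 < Q.ε ^ 2 := hy.trans_le hδ
  have hn : ‖Q.entDir s b y‖ = P.A.rad := norm_entDir hk hyε
  refine ⟨P.A.norm_lt_r₀_of_eq_rad hn, by rw [← norm_pos_iff, hn]; exact P.A.rad_pos, ?_, ?_, ?_⟩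
  · rw [ofChart_entDir hk hyε, P.A.hits_levelProj_iff]
    exact ⟨0, by rw [P.A.θ_zero]; exact apply_entW hk hyε⟩
  · rw [entOf_entDir hk hyε]; exact (entW_mem_Uent_iff hk hyε).2 hy
  · rw [entOf_entDir hk hyε, (entW_mem_chartBall (Q := Q) (s := s) (b := b) hyε).2]
    exact boolSign_mul_entPoint_zero_pos Q.ε_pos b y

/-- **`entDir ∘ entBack = id` on `entDom ∩ {‖u‖ = rad}`** (`δ ≤ ε²`). [folklore] -/
theorem entDir_entBack {δ : ℝ} (hδ : δ ≤ Q.ε ^ 2) {u : E3} (hu : u ∈ Q.entDom s b δ) (hun : ‖u‖ = P.A.rad) :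
    Q.entDir s b (Q.entBack s u) = u := by
  obtain ⟨-, hu0, hhit, hU, hsign⟩ := hu
  have heℓ : g (Q.entOf u) = Q.c - Q.ε ^ 2 := P.A.apply_levelProj hhit
  obtain ⟨b', y', hy', he⟩ := Q.exists_eq_entW_of_mem_Uent hk hU heℓ
  have hy'ε : ‖y'‖ ^ 2 < Q.ε ^ 2 := hy'.trans_le hδ
  -- the end is `b`
  have hcoord : (Q.DA s).coord (Q.entOf u) = entPoint Q.ε b' y' := by
    rw [he]; exact (entW_mem_chartBall (Q := Q) (s := s) (b := b') hy'ε).2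
  have hb : b' = b := by
    refine eq_of_boolSign_mul_pos (boolSign_mul_entPoint_zero_pos Q.ε_pos b' y') ?_
    rw [hcoord] at hsign; exact hsign
  subst hb
  -- `entBack u = y'`
  have hback : Q.entBack s u = y' := by rw [entBack_def, hcoord, yv_entPoint]
  rw [hback]
  -- the direction of `entW s b' y'` is the direction of `ofChart u`, namely `u`
  have hnc : ¬ IsMCriticalPt (𝓡∂ (2 + 1)) g (P.A.ofChart u) := P.A.not_isMCriticalPt_ofChart hun
  have hsph : Hits P.A.θ g P.A.sphR (P.A.ofChart u) := ⟨0, by rw [P.A.θ_zero]; exact (P.A.apply_ofChart_eq_sphR_iff (P.A.norm_lt_r₀_of_eq_rad hun).le).2 hun⟩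
  show P.A.dir (Q.entW s b' y') = u
  rw [← he, entOf_def, P.A.dir_levelProj hnc hsph, P.A.dir_ofChart hun]

omit hk in
/-- **The domain of the inverse is open.** [folklore] -/
theorem isOpen_entDom (δ : ℝ) : IsOpen (Q.entDom s b δ) := by
  rw [isOpen_iff_mem_nhds]
  rintro u ⟨hur, hu0, hhit, hU, hsign⟩
  have hgc : Continuous g := P.A.isMorseFunction.isMorse.contMDiff.continuous
  -- `ofChart` is continuous near `u`, the level point is continuous near `ofChart u`
  have hoc : ContinuousAt P.A.ofChart u := (BasinSetting.contMDiffAt_ofChart hur).continuousAt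
  have hxI : g (P.A.ofChart u) ∈ Ioo (g P.A.p₀) P.A.hi := by
    refine ⟨?_, (P.A.apply_ofChart_lt_sph hur).trans (P.A.sph_lt_L.trans P.A.L_lt_hi)⟩
    rw [P.A.apply_ofChart hur.le]; exact lt_add_of_pos_right _ (by positivity)
  have hnc : ¬ IsMCriticalPt (𝓡∂ (2 + 1)) g (P.A.ofChart u) :=
    P.A.not_isMCriticalPt_of_mem_basin (P.A.ofChart_mem_basin hur)
      (fun h => hu0 (by rw [← P.A.toChart_ofChart hur.le, h, P.A.toChart_p₀])) hxI.2.le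
  have hlp : ContinuousAt (levelProj P.A.θ g Q.entLevel) (P.A.ofChart u) :=
    (P.A.contMDiffAt_levelProj (P.A.apply_mem_slab hxI.2) hnc (P.A.Ioo_subset_Ioo_lo entLevel_mem_Ioo) hhit).continuousAt
  have hent : ContinuousAt Q.entOf u := hlp.comp hoc
  have h1 : {v : E3 | ‖v‖ < P.A.r₀} ∈ 𝓝 u := (isOpen_lt continuous_norm continuous_const).mem_nhds hur
  have h2 : {v : E3 | v ≠ 0} ∈ 𝓝 u := isOpen_ne.mem_nhds hu0
  have h3 : {v : E3 | Hits P.A.θ g Q.entLevel (P.A.ofChart v)} ∈ 𝓝 u :=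
    hoc.preimage_mem_nhds (P.A.hits_mem_nhds' (P.A.apply_mem_slab hxI.2) hnc (P.A.Ioo_subset_Ioo_lo entLevel_mem_Ioo) hhit)
  have h4 : {v : E3 | Q.entOf v ∈ Q.Uent s δ} ∈ 𝓝 u := hent.preimage_mem_nhds ((Q.isOpen_Uent s δ).mem_nhds hU)
  have h5 : {v : E3 | 0 < boolSign b * (Q.DA s).coord (Q.entOf v) 0} ∈ 𝓝 u := by
    have hco : ContinuousAt (fun v => (Q.DA s).coord (Q.entOf v) 0) u := by
      have hc1 : ContinuousAt (Q.DA s).coord (Q.entOf u) :=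
        ((Q.DA s).continuousOn_coord.continuousWithinAt hU.1.1).continuousAt ((Q.DA s).chart.open_source.mem_nhds hU.1.1)
      exact ((EuclideanSpace.proj (0 : Fin 3)).continuous.continuousAt.comp hc1).comp hent
    exact (continuousAt_const.mul hco).preimage_mem_nhds (isOpen_lt continuous_const continuous_id |>.mem_nhds hsign)
  filter_upwards [h1, h2, h3, h4, h5] with v hv1 hv2 hv3 hv4 hv5
  exact ⟨hv1, hv2, hv3, hv4, hv5⟩

omit hk in
/-- **The inverse is smooth on its domain.** [cite: MilnorHCobordism1965, proof of Thm. 5.4, Assertion 4 (PDF p. 29)] -/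
theorem contMDiffAt_entBack {δ : ℝ} {u : E3} (hu : u ∈ Q.entDom s b δ) :
    ContMDiffAt 𝓘(ℝ, E3) 𝓘(ℝ, E2) ∞ (Q.entBack s) u := by
  obtain ⟨hur, hu0, hhit, hU, -⟩ := hu
  have hxI : g (P.A.ofChart u) ∈ Ioo (g P.A.p₀) P.A.hi := by
    refine ⟨?_, (P.A.apply_ofChart_lt_sph hur).trans (P.A.sph_lt_L.trans P.A.L_lt_hi)⟩
    rw [P.A.apply_ofChart hur.le]; exact lt_add_of_pos_right _ (by positivity)
  have hnc : ¬ IsMCriticalPt (𝓡∂ (2 + 1)) g (P.A.ofChart u) :=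
    P.A.not_isMCriticalPt_of_mem_basin (P.A.ofChart_mem_basin hur)
      (fun h => hu0 (by rw [← P.A.toChart_ofChart hur.le, h, P.A.toChart_p₀])) hxI.2.le
  have h1 : ContMDiffAt 𝓘(ℝ, E3) (𝓡∂ (2 + 1)) ∞ Q.entOf u :=
    (P.A.contMDiffAt_levelProj (P.A.apply_mem_slab hxI.2) hnc (P.A.Ioo_subset_Ioo_lo entLevel_mem_Ioo) hhit).comp u
      (BasinSetting.contMDiffAt_ofChart hur)
  have h2 : ContMDiffAt (𝓡∂ (2 + 1)) 𝓘(ℝ, E3) ∞ (Q.DA s).coord (Q.entOf u) :=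
    ((Q.DA s).chart.contMDiffAt_extend (Q.DA s).mem_maximalAtlas hU.1.1).sub contMDiffAt_const
  have h3 : ContMDiffAt 𝓘(ℝ, E3) 𝓘(ℝ, E2) ∞ yv ((Q.DA s).coord (Q.entOf u)) := contDiff_yv.contDiffAt.contMDiffAt
  exact h3.comp u (h2.comp u h1)

end BasinPair.SaddleData

end Literature.Topology.FourManifolds
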